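import Mathlib
import Summits.NavierStokesRegularity.NavierStokesRegularity.Theorems.EulerZoomLiouvillePowerGaugeEulerLiouvilleEnergySaturationLoc
import HarnessLib

/-!
# Energy saturation on the crux `EulerZoomLiouville.PowerGaugeEulerLiouville` — SLOW RATES: a profile with class-`ρ` large-scale data
# obeying the self-similar local energy equality with a SUPER-CRITICAL drift `g = 1/(2+ρ') < 2/5` (`ρ' > ½`) VANISHES
# (crux = stmt-NavierStokesRegularity-19832, route №10 `EulerZoomLiouville`; line `logtime-breathers`, residue T4 `stub_powerClockRest`)

Width seat `ns-ezl-w6` (cell ns-regularity-ideate, LEAD ns-typeII-p2).  PROFILE-LEVEL lever behind «infinite-energy SLOW power clocks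
`0 < g < 2/5` about any `(T, x₀)` on a past sub-slab are trivial» (`…SelfSimilarSlowClockPast`).  Data: `V` with whole-space weak gradient `G`,
pressure profile `P`, the thresholded LARGE-SCALE class data (A₁) `∫_{B_L}|V|² ≤ c L^{1−2ρ}`, (E₁) `∫_{B_L}|G|²_F ≤ ((1−ρ)/(2+ρ))c·L^{1−ρ}`,
(D₁) `∫_{B_L}|P|^{3/2} ≤ ((2−2ρ)/(2+ρ))c·L^{2−2ρ}` (`L ≥ 1`), the weak Poisson equation, and the profile LOCAL ENERGY EQUALITY of a rate-`g`
collapse `(2 − 5g)∫θ|V|² = ∫(|V|²+2P)⟪V,∇θ⟫ + g∫|V|²⟪x,∇θ⟫`, `g = 1/(2+ρ')`.  The DATA exponent `ρ` and the RATE exponent `ρ'` are DECOUPLED: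
the tree's `ae_eq_zero_of_subExtremal_loc` is `ρ' = ρ` + sub-extremality, `OffRate.*` (ns-ezl-w4) is `ρ' < ρ` (sub-extremality automatic);
here `ρ' > ½`, with NO sub-extremality, NO finite energy, NO regularity.

* `slowRate_step` — BOOTSTRAP STEP (pure real analysis on the cut-off energy `J(R) = ∫σ(R⁻¹y)|V|²` and the flux `F`): `J ≤ C R^m` on
  `[L₁,∞)` (`m ≤ 1−2ρ`) ⇒ `J ≤ C' R^{max(m/2 − 5ρ/4, −κ/2)}`, `κ = 2ρ'−1 > 0`: the flux bound through the tail supremum gives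
  `|F(r)| ≤ B r^{m/2−5ρ/4}`, and the scale ODE `(R^κ J)' = (2+ρ')R^{κ−1}F` (`2 − 5g = gκ`) is compared with `(2+ρ')B R^ν/ν` by monotonicity.
* `slowRate_iterate` — from `m₀ = 1−2ρ` finitely many steps reach `m < 0` (each step lands at `−κ/2` or loses `≥ 5ρ/4`).
* `ae_eq_zero_of_slowRate_loc` — MAIN: (A₁), (E₁), (D₁) (`0 < ρ < 1`) + Poisson + the rate-`g` equality with `ρ' > ½` ⇒ `V = 0` a.e.

In words: for `g < 2/5` the own-rate extremal growth `R^{5−2/g}` is a DECAY, so ball energy must be fed by the flux, which is sub-linear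
(`∝ S^{1/2}`) in the energy — the bootstrap empties every ball.  Rates `g ∈ [2/5, 1/(2+ρ)]` are untouched (own-rate extremal growth survives).
WHAT THIS IS NOT: not NS regularity, not the crux — a lemma for one stratum of the crux CLASS 19832 on the MODEL lattice (`--supports`
stmt-19832). [folklore; cf. BronziShvydkoy2015 Thm 1.1, ChaeShvydkoy2013 §2.2 (2.12)]
-/

noncomputable section

-- flat `Theorems/<Route><Decl>…` files of one crux share the namespace of the crux (tree convention: `Summit.<S>.<S>.…`)
set_option linter.dupNamespace false

open MeasureTheory Set Filter Topology Metric Function TopologicalSpace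
open scoped ENNReal NNReal RealInnerProductSpace ContDiff Laplacian

namespace Summit.NavierStokesRegularity.NavierStokesRegularity.Theorems.PowerGaugeEulerLiouville

open Literature.Analysis Literature.Analysis.FunctionSpaces Literature.Analysis.FluidPDE

namespace EnergySaturation

section Bootstrap

variable {ρ ρ' : ℝ} {c : ℝ≥0} {A : ℝ} {J F : ℝ → ℝ}

/-- **THE BOOTSTRAP STEP** (pure real analysis).  `J ≥ 0`; the flux bound through the tail supremum with data exponent `ρ` (conclusion of
`exists_fluxWeight_le_of_sup_loc`); the scale ODE `(R^{2ρ'−1}J)'(r) = (2+ρ')r^{2ρ'−2}F(r)` with `ρ' > ½`.  If `J(R) ≤ C R^m` on `[L₁,∞)`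
(`m ≤ 1−2ρ`, `L₁ ≥ 1`) with admissible tail suprema `C r^{m−(1−2ρ)} ≤ 3c`, then `J(R) ≤ C' R^{max(m/2 − 5ρ/4, −(2ρ'−1)/2)}` on `[L₁,∞)`. [folklore] -/
theorem slowRate_step (hρ : 0 < ρ) (hρ' : 1 / 2 < ρ') (hA0 : 0 ≤ A)
    (hJ0 : ∀ R : ℝ, 0 < R → 0 ≤ J R)
    (hflux : ∀ S : ℝ, 0 ≤ S → S ≤ 3 * c → ∀ L : ℝ, 1 ≤ L →
      (∀ R : ℝ, L ≤ R → J R ≤ R ^ (1 - 2 * ρ) * S) →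
      ∀ r : ℝ, L ≤ r → |(2 + ρ) * r ^ (2 * ρ - 2) * F r| ≤ A * S ^ (1 / 2 : ℝ) * r ^ (-1 - (2 + ρ) / 4))
    (hderiv : ∀ r : ℝ, 0 < r →
      HasDerivAt (fun L : ℝ => L ^ (2 * ρ' - 1) * J L) ((2 + ρ') * r ^ (2 * ρ' - 2) * F r) r)
    {m C L₁ : ℝ} (hm : m ≤ 1 - 2 * ρ) (hC : 0 ≤ C) (hL₁ : 1 ≤ L₁)
    (hbound : ∀ R : ℝ, L₁ ≤ R → J R ≤ C * R ^ m)
    (h3c : ∀ r : ℝ, L₁ ≤ r → C * r ^ (m - (1 - 2 * ρ)) ≤ 3 * c) :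
    ∃ C' : ℝ, 0 ≤ C' ∧ ∀ R : ℝ, L₁ ≤ R →
      J R ≤ C' * R ^ max (m / 2 - 5 * ρ / 4) (-(2 * ρ' - 1) / 2) := by
  have h2ρ : 0 < 2 + ρ := by linarith
  have h2ρ' : 0 < 2 + ρ' := by linarith
  have hL₁0 : 0 < L₁ := lt_of_lt_of_le one_pos hL₁
  set κ : ℝ := 2 * ρ' - 1 with hκ
  have hκ0 : 0 < κ := by rw [hκ]; linarith
  set μ : ℝ := m / 2 - 5 * ρ / 4 with hμ
  set mp : ℝ := max μ (-κ / 2) with hmp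
  set ν : ℝ := κ + mp with hν
  have hν0 : 0 < ν := by
    have : -κ / 2 ≤ mp := le_max_right _ _
    rw [hν]; linarith
  have hκμν : κ + μ ≤ ν := by
    have : μ ≤ mp := le_max_left _ _
    rw [hν]; linarith
  set B : ℝ := A * C ^ (1 / 2 : ℝ) / (2 + ρ) with hB
  have hB0 : 0 ≤ B := by rw [hB]; positivity
  -- ### (1) the pointwise flux bound `|F r| ≤ B r^μ` on `[L₁, ∞)`
  have hFle : ∀ r : ℝ, L₁ ≤ r → |F r| ≤ B * r ^ μ := by
    intro r hr
    have hr1 : 1 ≤ r := hL₁.trans hr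
    have hr0 : 0 < r := lt_of_lt_of_le one_pos hr1
    set S : ℝ := C * r ^ (m - (1 - 2 * ρ)) with hS
    have hS0 : 0 ≤ S := by rw [hS]; exact mul_nonneg hC (Real.rpow_nonneg hr0.le _)
    have hS3 : S ≤ 3 * c := h3c r hr
    have htail : ∀ R : ℝ, r ≤ R → J R ≤ R ^ (1 - 2 * ρ) * S := by
      intro R hR
      have hR0 : 0 < R := lt_of_lt_of_le hr0 hR
      have hRr : R ^ (m - (1 - 2 * ρ)) ≤ r ^ (m - (1 - 2 * ρ)) :=
        Real.rpow_le_rpow_of_nonpos hr0 hR (by linarith)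
      have hsplit : C * R ^ m = R ^ (1 - 2 * ρ) * (C * R ^ (m - (1 - 2 * ρ))) := by
        have : R ^ m = R ^ (1 - 2 * ρ) * R ^ (m - (1 - 2 * ρ)) := by
          rw [← Real.rpow_add hR0]; ring_nf
        rw [this]; ring
      calc J R ≤ C * R ^ m := hbound R (hr.trans hR)
        _ = R ^ (1 - 2 * ρ) * (C * R ^ (m - (1 - 2 * ρ))) := hsplit
        _ ≤ R ^ (1 - 2 * ρ) * S := by
            rw [hS]
            exact mul_le_mul_of_nonneg_left (mul_le_mul_of_nonneg_left hRr hC) (Real.rpow_nonneg hR0.le _)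
    have hfl := hflux S hS0 hS3 r hr1 htail r le_rfl
    have hw0 : 0 < (2 + ρ) * r ^ (2 * ρ - 2) := mul_pos h2ρ (Real.rpow_pos_of_pos hr0 _)
    rw [abs_mul, abs_of_pos hw0] at hfl
    have hS12 : S ^ (1 / 2 : ℝ) = C ^ (1 / 2 : ℝ) * r ^ ((m - (1 - 2 * ρ)) / 2) := by
      rw [hS, Real.mul_rpow hC (Real.rpow_nonneg hr0.le _), ← Real.rpow_mul hr0.le]
      congr 1; ring_nf
    have hkey : |F r| ≤ (A * S ^ (1 / 2 : ℝ) * r ^ (-1 - (2 + ρ) / 4)) / ((2 + ρ) * r ^ (2 * ρ - 2)) := by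
      rw [le_div_iff₀ hw0]
      calc |F r| * ((2 + ρ) * r ^ (2 * ρ - 2)) = (2 + ρ) * r ^ (2 * ρ - 2) * |F r| := by ring
        _ ≤ A * S ^ (1 / 2 : ℝ) * r ^ (-1 - (2 + ρ) / 4) := hfl
    refine hkey.trans (le_of_eq ?_)
    rw [hS12, hB, div_eq_iff hw0.ne']
    have hpow : r ^ ((m - (1 - 2 * ρ)) / 2) * r ^ (-1 - (2 + ρ) / 4) = r ^ μ * r ^ (2 * ρ - 2) := by
      rw [← Real.rpow_add hr0, ← Real.rpow_add hr0, hμ]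
      congr 1; ring
    calc A * (C ^ (1 / 2 : ℝ) * r ^ ((m - (1 - 2 * ρ)) / 2)) * r ^ (-1 - (2 + ρ) / 4)
        = A * C ^ (1 / 2 : ℝ) * (r ^ ((m - (1 - 2 * ρ)) / 2) * r ^ (-1 - (2 + ρ) / 4)) := by ring
      _ = A * C ^ (1 / 2 : ℝ) * (r ^ μ * r ^ (2 * ρ - 2)) := by rw [hpow]
      _ = A * C ^ (1 / 2 : ℝ) / (2 + ρ) * r ^ μ * ((2 + ρ) * r ^ (2 * ρ - 2)) := by
          field_simp
  -- ### (2) comparison: `Φ(R) = R^κ J(R) − (2+ρ') B R^ν / ν` is non-increasing on `[L₁, ∞)`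
  set Φ : ℝ → ℝ := fun R => R ^ κ * J R - (2 + ρ') * B / ν * R ^ ν with hΦ
  have hΦderiv : ∀ r : ℝ, L₁ ≤ r →
      HasDerivAt Φ ((2 + ρ') * r ^ (2 * ρ' - 2) * F r - (2 + ρ') * B * r ^ (ν - 1)) r := by
    intro r hr
    have hr0 : 0 < r := lt_of_lt_of_le hL₁0 hr
    have h1 : HasDerivAt (fun L : ℝ => L ^ κ * J L) ((2 + ρ') * r ^ (2 * ρ' - 2) * F r) r := by
      have := hderiv r hr0
      rw [hκ]; exact this
    have h2 : HasDerivAt (fun L : ℝ => (2 + ρ') * B / ν * L ^ ν) ((2 + ρ') * B * r ^ (ν - 1)) r := by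
      have h := (Real.hasDerivAt_rpow_const (x := r) (p := ν) (Or.inl hr0.ne')).const_mul ((2 + ρ') * B / ν)
      have e : (2 + ρ') * B / ν * (ν * r ^ (ν - 1)) = (2 + ρ') * B * r ^ (ν - 1) := by
        field_simp
      rw [e] at h
      exact h
    have h := h1.sub h2
    simp only [hΦ]
    convert h using 1 <;> rfl
  have hΦ'le : ∀ r : ℝ, L₁ ≤ r →
      (2 + ρ') * r ^ (2 * ρ' - 2) * F r - (2 + ρ') * B * r ^ (ν - 1) ≤ 0 := by
    intro r hr
    have hr1 : 1 ≤ r := hL₁.trans hr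
    have hr0 : 0 < r := lt_of_lt_of_le one_pos hr1
    have hF := hFle r hr
    have hw : 0 ≤ (2 + ρ') * r ^ (2 * ρ' - 2) := mul_nonneg h2ρ'.le (Real.rpow_nonneg hr0.le _)
    have h1 : (2 + ρ') * r ^ (2 * ρ' - 2) * F r ≤ (2 + ρ') * r ^ (2 * ρ' - 2) * (B * r ^ μ) :=
      mul_le_mul_of_nonneg_left ((le_abs_self _).trans hF) hw
    have h2 : r ^ (2 * ρ' - 2) * r ^ μ ≤ r ^ (ν - 1) := by
      rw [← Real.rpow_add hr0]
      exact Real.rpow_le_rpow_of_exponent_le hr1 (by rw [hκ] at hκμν; linarith)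
    have h3 : (2 + ρ') * r ^ (2 * ρ' - 2) * (B * r ^ μ) ≤ (2 + ρ') * B * r ^ (ν - 1) := by
      calc (2 + ρ') * r ^ (2 * ρ' - 2) * (B * r ^ μ) = (2 + ρ') * B * (r ^ (2 * ρ' - 2) * r ^ μ) := by ring
        _ ≤ (2 + ρ') * B * r ^ (ν - 1) := mul_le_mul_of_nonneg_left h2 (by positivity)
    linarith
  have hΦanti : AntitoneOn Φ (Ici L₁) := by
    have hcont : ContinuousOn Φ (Ici L₁) := fun r hr =>
      (hΦderiv r (mem_Ici.1 hr)).continuousAt.continuousWithinAt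
    have hdiff : DifferentiableOn ℝ Φ (interior (Ici L₁)) := by
      rw [interior_Ici]
      exact fun r hr => (hΦderiv r (le_of_lt (mem_Ioi.1 hr))).differentiableAt.differentiableWithinAt
    refine antitoneOn_of_deriv_nonpos (convex_Ici L₁) hcont hdiff fun r hr => ?_
    rw [interior_Ici] at hr
    have hr' : L₁ ≤ r := le_of_lt (mem_Ioi.1 hr)
    rw [(hΦderiv r hr').deriv]
    exact hΦ'le r hr'
  -- ### (3) the new power bound
  set C' : ℝ := L₁ ^ κ * J L₁ + (2 + ρ') * B / ν with hC'
  have hC'0 : 0 ≤ C' := by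
    rw [hC']
    exact add_nonneg (mul_nonneg (Real.rpow_nonneg hL₁0.le _) (hJ0 L₁ hL₁0)) (by positivity)
  refine ⟨C', hC'0, fun R hR => ?_⟩
  have hR1 : 1 ≤ R := hL₁.trans hR
  have hR0 : 0 < R := lt_of_lt_of_le one_pos hR1
  have hΦle : Φ R ≤ Φ L₁ := hΦanti (mem_Ici.2 le_rfl) (mem_Ici.2 hR) hR
  have hRν1 : 1 ≤ R ^ ν := Real.one_le_rpow hR1 hν0.le
  have hL₁ν : 0 ≤ (2 + ρ') * B / ν * L₁ ^ ν := by positivity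
  have hRκJ : R ^ κ * J R ≤ C' * R ^ ν := by
    have h1 : R ^ κ * J R ≤ L₁ ^ κ * J L₁ + (2 + ρ') * B / ν * R ^ ν := by
      have := hΦle
      simp only [hΦ] at this
      linarith
    have h2 : L₁ ^ κ * J L₁ ≤ L₁ ^ κ * J L₁ * R ^ ν := by
      have h0 : 0 ≤ L₁ ^ κ * J L₁ := mul_nonneg (Real.rpow_nonneg hL₁0.le _) (hJ0 L₁ hL₁0)
      nlinarith
    calc R ^ κ * J R ≤ L₁ ^ κ * J L₁ + (2 + ρ') * B / ν * R ^ ν := h1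
      _ ≤ L₁ ^ κ * J L₁ * R ^ ν + (2 + ρ') * B / ν * R ^ ν := by linarith
      _ = C' * R ^ ν := by rw [hC']; ring
  have hRκ0 : 0 < R ^ κ := Real.rpow_pos_of_pos hR0 _
  have hνκ : R ^ ν = R ^ κ * R ^ mp := by
    rw [← Real.rpow_add hR0, hν]
  rw [hνκ] at hRκJ
  have : R ^ κ * J R ≤ R ^ κ * (C' * R ^ mp) := by
    calc R ^ κ * J R ≤ C' * (R ^ κ * R ^ mp) := hRκJ
      _ = R ^ κ * (C' * R ^ mp) := by ring
  exact le_of_mul_le_mul_left this hRκ0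

/-- **FINITELY MANY BOOTSTRAP STEPS REACH A NEGATIVE EXPONENT** (`c > 0`): from `J(R) ≤ C₀ R^{1−2ρ}` on `[1,∞)`, `C₀ ≤ 3c`, there are
`m < 0`, `C ≥ 0`, `L₁ ≥ 1` with `J(R) ≤ C R^m` on `[L₁,∞)` (while `m ≥ 0` a step lands at `−κ/2 < 0` or loses at least `5ρ/4`). [folklore] -/
theorem slowRate_iterate (hρ : 0 < ρ) (hρ' : 1 / 2 < ρ') (hc : 0 < (c : ℝ)) (hA0 : 0 ≤ A)
    (hJ0 : ∀ R : ℝ, 0 < R → 0 ≤ J R)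
    (hflux : ∀ S : ℝ, 0 ≤ S → S ≤ 3 * c → ∀ L : ℝ, 1 ≤ L →
      (∀ R : ℝ, L ≤ R → J R ≤ R ^ (1 - 2 * ρ) * S) →
      ∀ r : ℝ, L ≤ r → |(2 + ρ) * r ^ (2 * ρ - 2) * F r| ≤ A * S ^ (1 / 2 : ℝ) * r ^ (-1 - (2 + ρ) / 4))
    (hderiv : ∀ r : ℝ, 0 < r →
      HasDerivAt (fun L : ℝ => L ^ (2 * ρ' - 1) * J L) ((2 + ρ') * r ^ (2 * ρ' - 2) * F r) r)
    {C₀ : ℝ} (hC₀ : 0 ≤ C₀) (hC₀3 : C₀ ≤ 3 * c)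
    (hbase : ∀ R : ℝ, 1 ≤ R → J R ≤ C₀ * R ^ (1 - 2 * ρ)) :
    ∃ m C L₁ : ℝ, m < 0 ∧ 0 ≤ C ∧ 1 ≤ L₁ ∧ ∀ R : ℝ, L₁ ≤ R → J R ≤ C * R ^ m := by
  set κ : ℝ := 2 * ρ' - 1 with hκ
  have hκ0 : 0 < κ := by rw [hκ]; linarith
  set d : ℝ := 5 * ρ / 4 with hd
  have hd0 : 0 < d := by rw [hd]; positivity
  have hQ : ∀ k : ℕ, ∃ m C L₁ : ℝ, 0 ≤ C ∧ 1 ≤ L₁ ∧ (∀ R : ℝ, L₁ ≤ R → J R ≤ C * R ^ m) ∧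
      (m < 0 ∨ (m ≤ 1 - 2 * ρ - k * d ∧ m ≤ 1 - 2 * ρ ∧
        ∀ r : ℝ, L₁ ≤ r → C * r ^ (m - (1 - 2 * ρ)) ≤ 3 * c)) := by
    intro k
    induction k with
    | zero =>
      refine ⟨1 - 2 * ρ, C₀, 1, hC₀, le_rfl, hbase, Or.inr ⟨by simp, le_rfl, fun r hr => ?_⟩⟩
      rw [sub_self, Real.rpow_zero, mul_one]
      exact hC₀3
    | succ k ih =>
      obtain ⟨m, C, L₁, hC, hL₁, hb, hcase⟩ := ih
      rcases hcase with hneg | ⟨hmk, hm, h3c⟩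
      · exact ⟨m, C, L₁, hC, hL₁, hb, Or.inl hneg⟩
      by_cases hm0 : m < 0
      · exact ⟨m, C, L₁, hC, hL₁, hb, Or.inl hm0⟩
      push Not at hm0
      obtain ⟨C', hC'0, hb'⟩ := slowRate_step hρ hρ' hA0 hJ0 hflux hderiv hm hC hL₁ hb h3c
      set mp : ℝ := max (m / 2 - 5 * ρ / 4) (-(2 * ρ' - 1) / 2) with hmp
      by_cases hmp0 : mp < 0
      · exact ⟨mp, C', L₁, hC'0, hL₁, hb', Or.inl hmp0⟩
      push Not at hmp0
      have hneg2 : -(2 * ρ' - 1) / 2 < 0 := by linarith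
      have hmp_eq : mp = m / 2 - 5 * ρ / 4 := by
        rw [hmp]
        refine max_eq_left ?_
        by_contra hlt
        push Not at hlt
        have : mp = -(2 * ρ' - 1) / 2 := by rw [hmp]; exact max_eq_right hlt.le
        linarith
      have hmp_lt : mp < m := by
        rw [hmp_eq]; nlinarith
      have hmp_k : mp ≤ 1 - 2 * ρ - (↑(k + 1) : ℝ) * d := by
        rw [hmp_eq, hd]; push_cast; rw [hd] at hmk; nlinarith
      have hmp_le : mp ≤ 1 - 2 * ρ := by linarith
      -- the exponent `mp − (1−2ρ) < 0`: enlarge the threshold so that the tail suprema are admissible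
      have hexp : mp - (1 - 2 * ρ) < 0 := by linarith
      have htend : Tendsto (fun r : ℝ => C' * r ^ (mp - (1 - 2 * ρ))) atTop (𝓝 (C' * 0)) := by
        refine tendsto_const_nhds.mul ?_
        have := tendsto_rpow_neg_atTop (y := -(mp - (1 - 2 * ρ))) (by linarith)
        simpa using this
      rw [mul_zero] at htend
      have h3c0 : (0 : ℝ) < 3 * c := by positivity
      obtain ⟨L₂, hL₂δ, hL₂ge⟩ :=
        ((htend.eventually (gt_mem_nhds h3c0)).and (eventually_ge_atTop L₁)).exists
      have hL₂1 : 1 ≤ L₂ := hL₁.trans hL₂ge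
      have hL₂0 : 0 < L₂ := lt_of_lt_of_le one_pos hL₂1
      refine ⟨mp, C', L₂, hC'0, hL₂1, fun R hR => hb' R (hL₂ge.trans hR), Or.inr ⟨hmp_k, hmp_le, fun r hr => ?_⟩⟩
      have hr0 : 0 < r := lt_of_lt_of_le hL₂0 hr
      have hmono : r ^ (mp - (1 - 2 * ρ)) ≤ L₂ ^ (mp - (1 - 2 * ρ)) :=
        Real.rpow_le_rpow_of_nonpos hL₂0 hr hexp.le
      calc C' * r ^ (mp - (1 - 2 * ρ)) ≤ C' * L₂ ^ (mp - (1 - 2 * ρ)) := mul_le_mul_of_nonneg_left hmono hC'0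
        _ ≤ 3 * c := hL₂δ.le
  obtain ⟨k, hk⟩ := exists_nat_gt ((1 - 2 * ρ) / d)
  obtain ⟨m, C, L₁, hC, hL₁, hb, hcase⟩ := hQ k
  have hmneg : m < 0 := by
    rcases hcase with h | ⟨hmk, -, -⟩
    · exact h
    · have : (1 - 2 * ρ) < k * d := by rwa [div_lt_iff₀ hd0] at hk
      linarith
  exact ⟨m, C, L₁, hmneg, hC, hL₁, hb⟩

end Bootstrap

variable {ρ ρ' : ℝ}
  {V : EuclideanSpace ℝ (Fin 3) → EuclideanSpace ℝ (Fin 3)} {P : EuclideanSpace ℝ (Fin 3) → ℝ}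
  {G : EuclideanSpace ℝ (Fin 3) → EuclideanSpace ℝ (Fin 3) →L[ℝ] EuclideanSpace ℝ (Fin 3)}

/-- **SLOW-RATE PROFILES WITH CLASS DATA ARE TRIVIAL.**  `(V, P, G)` with the thresholded class data (A₁), (E₁), (D₁) of DATA exponent
`0 < ρ < 1`, the weak Poisson equation, and the profile local energy EQUALITY of a self-similar collapse with RATE exponent `ρ' > ½` (drift rate
`g = 1/(2+ρ') < 2/5`) for every test function: `V = 0` a.e. — no sub-extremality, no finite energy, no regularity; the rate alone kills.
(`ρ' = ρ`: `ae_eq_zero_of_subExtremal_loc` needs sub-extremality; `ρ' < ρ`: `OffRate.*`.) [folklore; cf. BronziShvydkoy2015 Thm 1.1] -/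
theorem ae_eq_zero_of_slowRate_loc (hρ : 0 < ρ) (hρ1 : ρ < 1) (hρ' : 1 / 2 < ρ')
    (hVm : AEStronglyMeasurable V volume) (hPm : AEStronglyMeasurable P volume)
    (hGm : AEStronglyMeasurable G volume)
    (hVG : HasWeakFDerivOn (⊤ : Opens (EuclideanSpace ℝ (Fin 3))) volume V G) {c : ℝ≥0}
    (hA : ∀ L : ℝ, 1 ≤ L → ∫⁻ y in ball (0 : EuclideanSpace ℝ (Fin 3)) L, ‖V y‖ₑ ^ 2 ≤
      (c : ℝ≥0∞) * ENNReal.ofReal (L ^ (1 - 2 * ρ)))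
    (hE : ∀ L : ℝ, 1 ≤ L →
      ∫⁻ y in ball (0 : EuclideanSpace ℝ (Fin 3)) L, ENNReal.ofReal (frobeniusNormSq (G y)) ≤
        ENNReal.ofReal (L ^ (1 - ρ)) * (ENNReal.ofReal ((1 - ρ) / (2 + ρ)) * (c : ℝ≥0∞)))
    (hD : ∀ L : ℝ, 1 ≤ L →
      ∫⁻ y in ball (0 : EuclideanSpace ℝ (Fin 3)) L, ‖P y‖ₑ ^ (3 / 2 : ℝ) ≤
        ENNReal.ofReal (L ^ (2 - 2 * ρ)) * (ENNReal.ofReal ((2 - 2 * ρ) / (2 + ρ)) * (c : ℝ≥0∞)))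
    (hPoisson : ∀ θ : EuclideanSpace ℝ (Fin 3) → ℝ, ContDiff ℝ (⊤ : ℕ∞) θ → HasCompactSupport θ →
      ∫ y, P y * (Δ θ) y = -∫ y, fderiv ℝ (fderiv ℝ θ) y (V y) (V y))
    (hEE : ∀ θ : EuclideanSpace ℝ (Fin 3) → ℝ, IsTestFunctionOn (⊤ : Opens (EuclideanSpace ℝ (Fin 3))) θ →
      (2 - 5 * (1 / (2 + ρ'))) * ∫ x, θ x * ‖V x‖ ^ 2 =
        (∫ x, (‖V x‖ ^ 2 + 2 * P x) * ⟪V x, gradient θ x⟫) +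
          (1 / (2 + ρ')) * ∫ x, ‖V x‖ ^ 2 * ⟪x, gradient θ x⟫) :
    V =ᵐ[volume] 0 := by
  have hc0 : (0 : ℝ) ≤ c := c.2
  have hρ'0 : 0 < ρ' := by linarith
  have hV2 : LocallyIntegrable (fun y => ‖V y‖ ^ 2) volume := locallyIntegrable_norm_sq_of_growth_loc hVm hA
  obtain ⟨σ, hσs, hσc, h0, h1, hone, hzero, -⟩ := exists_radialCutoff
  have hσ : IsTestFunctionOn (⊤ : Opens (EuclideanSpace ℝ (Fin 3))) σ := ⟨hσs, hσc, fun _ _ => trivial⟩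
  set J : ℝ → ℝ := fun R => ∫ y, σ (R⁻¹ • y) * ‖V y‖ ^ 2 with hJ
  set F : ℝ → ℝ := fun r => ∫ x, (‖V x‖ ^ 2 + 2 * P x) * ⟪V x, gradient (fun z => σ (r⁻¹ • z)) x⟫ with hF
  have hJ0 : ∀ R : ℝ, 0 < R → 0 ≤ J R := fun R _ =>
    integral_nonneg fun y => mul_nonneg (h0 _) (sq_nonneg _)
  -- ### a NEGATIVE power bound on `J` at large scales
  have hpow : ∃ m C L₁ : ℝ, m < 0 ∧ 0 ≤ C ∧ 1 ≤ L₁ ∧ ∀ R : ℝ, L₁ ≤ R → J R ≤ C * R ^ m := by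
    by_cases hc : (c : ℝ) = 0
    · -- `c = 0`: the `A`-growth already gives `J ≤ 0`
      refine ⟨-1, 0, 1, by norm_num, le_rfl, le_rfl, fun R hR => ?_⟩
      have hR0 : 0 < R := lt_of_lt_of_le one_pos hR
      have h := normEnergy_le_of_growth_loc (ρ := ρ) h0 h1 hzero hVm hA hR
      rw [hc, mul_zero] at h
      have hRp : 0 < R ^ (2 * ρ - 1) := Real.rpow_pos_of_pos hR0 _
      have hJle : J R ≤ 0 := by
        have : R ^ (2 * ρ - 1) * J R ≤ R ^ (2 * ρ - 1) * 0 := by rw [mul_zero]; exact h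
        exact le_of_mul_le_mul_left this hRp
      simpa using hJle
    have hcpos : 0 < (c : ℝ) := lt_of_le_of_ne hc0 (Ne.symm hc)
    have hEEσ : ∀ L : ℝ, 0 < L → (2 - 5 * (1 / (2 + ρ'))) * ∫ x, σ (L⁻¹ • x) * ‖V x‖ ^ 2 =
        (∫ x, (‖V x‖ ^ 2 + 2 * P x) * ⟪V x, gradient (fun z => σ (L⁻¹ • z)) x⟫) +
          (1 / (2 + ρ')) * ∫ x, ‖V x‖ ^ 2 * ⟪x, gradient (fun z => σ (L⁻¹ • z)) x⟫ :=
      fun L hL => hEE _ (isTestFunctionOn_comp_inv_smul hσ hL.ne')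
    have hderiv : ∀ r : ℝ, 0 < r →
        HasDerivAt (fun L : ℝ => L ^ (2 * ρ' - 1) * J L) ((2 + ρ') * r ^ (2 * ρ' - 2) * F r) r :=
      fun r hr => hasDerivAt_normEnergy_of_energyEquality hρ'0 hσ hVm hV2 hr (hEEσ r hr)
    obtain ⟨A, hA0, hfluxW⟩ := exists_fluxWeight_le_of_sup_loc hρ hρ1 hσ h0 h1 hone hzero hVm hPm hGm hVG hA hE hD
      hPoisson
    have hflux : ∀ S : ℝ, 0 ≤ S → S ≤ 3 * c → ∀ L : ℝ, 1 ≤ L →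
        (∀ R : ℝ, L ≤ R → J R ≤ R ^ (1 - 2 * ρ) * S) →
        ∀ r : ℝ, L ≤ r → |(2 + ρ) * r ^ (2 * ρ - 2) * F r| ≤ A * S ^ (1 / 2 : ℝ) * r ^ (-1 - (2 + ρ) / 4) :=
      fun S hS hS3 L hL hsup r hr => hfluxW S hS hS3 L hL hsup r hr
    set C₀ : ℝ := (3 : ℝ) ^ (1 - 2 * ρ) * c with hC₀
    have hC₀0 : 0 ≤ C₀ := by rw [hC₀]; positivity
    have hC₀3 : C₀ ≤ 3 * c := by
      have h3 : (3 : ℝ) ^ (1 - 2 * ρ) ≤ 3 := by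
        conv_rhs => rw [← Real.rpow_one 3]
        exact Real.rpow_le_rpow_of_exponent_le (by norm_num) (by linarith)
      rw [hC₀]; gcongr
    have hbase : ∀ R : ℝ, 1 ≤ R → J R ≤ C₀ * R ^ (1 - 2 * ρ) := by
      intro R hR
      have hR0 : 0 < R := lt_of_lt_of_le one_pos hR
      have h := normEnergy_le_of_growth_loc (ρ := ρ) h0 h1 hzero hVm hA hR
      have hRR : R ^ (1 - 2 * ρ) * R ^ (2 * ρ - 1) = 1 := by rw [← Real.rpow_add hR0]; norm_num
      calc J R = R ^ (1 - 2 * ρ) * (R ^ (2 * ρ - 1) * J R) := by rw [← mul_assoc, hRR, one_mul]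
        _ ≤ R ^ (1 - 2 * ρ) * ((3 : ℝ) ^ (1 - 2 * ρ) * c) :=
            mul_le_mul_of_nonneg_left h (Real.rpow_nonneg hR0.le _)
        _ = C₀ * R ^ (1 - 2 * ρ) := by rw [hC₀]; ring
    exact slowRate_iterate hρ hρ' hcpos hA0 hJ0 hflux hderiv hC₀0 hC₀3 hbase
  obtain ⟨m, C, L₁, hm, hC, hL₁, hb⟩ := hpow
  -- ### CONCLUSION: the energy of every ball vanishes
  have hballzero : ∀ L₀ : ℝ, 0 < L₀ → ∫⁻ y in ball (0 : EuclideanSpace ℝ (Fin 3)) L₀, ‖V y‖ₑ ^ 2 = 0 := by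
    intro L₀ hL₀
    refine le_antisymm (ENNReal.le_of_forall_pos_le_add fun δ hδ _ => ?_) zero_le
    rw [zero_add]
    have htend : Tendsto (fun L : ℝ => C * L ^ m) atTop (𝓝 (C * 0)) := by
      refine tendsto_const_nhds.mul ?_
      have := tendsto_rpow_neg_atTop (y := -m) (by linarith)
      simpa using this
    rw [mul_zero] at htend
    have hev := (htend.eventually (gt_mem_nhds (show (0 : ℝ) < δ from hδ))).and
      (eventually_ge_atTop (max L₀ L₁))
    obtain ⟨L, hLδ, hLge⟩ := hev.exists
    have hLL₁ : L₁ ≤ L := (le_max_right _ _).trans hLge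
    have hL0 : 0 < L := lt_of_lt_of_le (lt_of_lt_of_le one_pos hL₁) hLL₁
    have hLL₀ : L₀ ≤ L := (le_max_left _ _).trans hLge
    have h1 := lintegral_ball_sq_le_cutoffEnergy hσs.continuous hσc h0 hone hV2 hL0
    calc ∫⁻ y in ball (0 : EuclideanSpace ℝ (Fin 3)) L₀, ‖V y‖ₑ ^ 2
        ≤ ∫⁻ y in ball (0 : EuclideanSpace ℝ (Fin 3)) L, ‖V y‖ₑ ^ 2 := lintegral_mono_set (ball_subset_ball hLL₀)
      _ ≤ ENNReal.ofReal (J L) := h1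
      _ ≤ ENNReal.ofReal (C * L ^ m) := ENNReal.ofReal_le_ofReal (hb L hLL₁)
      _ ≤ (δ : ℝ≥0∞) := by
          rw [← ENNReal.ofReal_coe_nnreal]; exact ENNReal.ofReal_le_ofReal hLδ.le
  have hball_ae : ∀ n : ℕ, ∀ᵐ y ∂(volume.restrict (ball (0 : EuclideanSpace ℝ (Fin 3)) ((n : ℝ) + 1))), V y = 0 := by
    intro n
    have h := hballzero ((n : ℝ) + 1) (by positivity)
    rw [lintegral_eq_zero_iff' (hVm.restrict.enorm.pow_const 2)] at h
    filter_upwards [h] with y hy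
    simpa using hy
  have hunion : (⋃ n : ℕ, ball (0 : EuclideanSpace ℝ (Fin 3)) ((n : ℝ) + 1)) = univ := by
    refine eq_univ_of_forall fun y => mem_iUnion.2 ?_
    obtain ⟨n, hn⟩ := exists_nat_gt ‖y‖
    exact ⟨n, by rw [mem_ball, dist_zero_right]; linarith⟩
  have h := (ae_restrict_iUnion_iff (μ := (volume : Measure (EuclideanSpace ℝ (Fin 3))))
    (fun n : ℕ => ball (0 : EuclideanSpace ℝ (Fin 3)) ((n : ℝ) + 1)) (fun y => V y = 0)).2 hball_ae
  rw [hunion, Measure.restrict_univ] at h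
  exact h

end EnergySaturation

end Summit.NavierStokesRegularity.NavierStokesRegularity.Theorems.PowerGaugeEulerLiouville

end
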